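import Literature.Analysis.FluidPDE.CKNEpsilonRegularityAssembly
import Literature.Analysis.FluidPDE.LocalTypeIScaling
import Literature.Analysis.FluidPDE.TaoEnstrophyLocalisationProofs
import Literature.Analysis.FluidPDE.WeakGradientSlicing
import Literature.Analysis.FunctionSpaces.BallLipschitzDomain
import Literature.Analysis.FunctionSpaces.SobolevTraceEmbeddingProofs
import HarnessLib

/-!
# The interpolation inequality `C(r) ≤ C₀ (A(r) + E(r))^{3/2}` (Robinson–Rodrigo–Sadowski, Lemma 15.10)

Analysis/FluidPDE file in the decomposition of the named fact
`Literature.Analysis.FluidPDE.ckn_epsilon_regularity` (`PartialRegularity.lean`, ns.S12: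
Caffarelli–Kohn–Nirenberg 1982, Proposition 2). Of the four analytic estimates from which
`Literature.Analysis.FluidPDE.ckn_epsilon_regularity_of_estimates` (`CKNEpsilonRegularityAssembly.lean`) derives
ns.S12, this file **proves** the interpolation inequality
`Literature.Analysis.FluidPDE.interpolationEstimate` (Robinson–Rodrigo–Sadowski 2016, Lemma 15.10, (15.31);
Caffarelli–Kohn–Nirenberg 1982, §2, (2.8)–(2.10) and Lemma 5.1): there is an absolute constant
`C₀` such that for every field `u` with weak spatial gradient `G` on a parabolic cylinder
`Q_r(z)`, `z = (t, x)`,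
`C(r) ≤ C₀ (A(r) + E(r))^{3/2}`, where `C(r) = r⁻² ∫∫_{Q_r} |u|³`,
`A(r) = ess sup_s r⁻¹ ∫_{B_r} |u(s)|²`, `E(r) = r⁻¹ ∫∫_{Q_r} |∇u|²` (accepted `Fluid.cknC`,
`cknAEss`, `Fluid.cknE`).

## Proof (Robinson–Rodrigo–Sadowski 2016, proof of Lemma 15.10)

By the Navier–Stokes scaling (`Literature.Analysis.FluidPDE.cknC_nsZoom`, `cknAEss_nsZoom`, `cknE_nsZoom`,
`HasWeakSpatialGradientOn.stRescale`) it suffices to treat `r = 1`, `z = 0`,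
`Q₁ = (-1, 0) × B₁`. For a.e. `s ∈ (-1, 0)` the slice `u(s)` has the weak derivative `G(s)`
on `B₁` (`HasWeakSpatialGradientOn.ae_hasWeakFDerivOn_ball`, `WeakGradientSlicing.lean`),
`∫_{B₁} |u(s)|² ≤ A` and `∫_{B₁} |G(s)|² < ∞`; so `u(s) ∈ W^{1,2}(B₁)` and the Sobolev
inequality on the unit ball — a bounded Lipschitz domain (`isLipschitzDomain_ball`), whence the
tree's embedding `Literature.Analysis.FunctionSpaces.exists_eLpNorm_le_of_memSobolevDomain_one` applies —
gives `‖u(s)‖_{L⁶(B₁)} ≤ C_S (‖u(s)‖_{L²(B₁)} + ‖G(s)‖_{L²(B₁)})`. By Hölder,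
`∫_{B₁} |u(s)|³ ≤ (∫_{B₁} |u(s)|²)^{3/4} (∫_{B₁} |u(s)|⁶)^{1/4} ≤ A^{3/4} (2 C_S)^{3/2} (a(s) + e(s))^{3/4}`
with `a(s) = ∫_{B₁} |u(s)|²`, `e(s) = ∫_{B₁} |G(s)|²`; integrating in `s` (Tonelli) and applying
Hölder in time, `∫_{-1}^0 (a + e)^{3/4} ≤ (∫_{-1}^0 (a + e))^{3/4} ≤ (A + E)^{3/4}`, so that
`C(1) ≤ (2 C_S)^{3/2} A^{3/4} (A + E)^{3/4} ≤ (2 C_S)^{3/2} (A + E)^{3/2}`.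

## References

* J. C. Robinson, J. L. Rodrigo, W. Sadowski, *The three-dimensional Navier–Stokes equations*,
  Cambridge Studies in Advanced Mathematics 157 (2016), Lemma 15.10, (15.31), Lemma 3.5.
* L. Caffarelli, R. Kohn, L. Nirenberg, *Partial regularity of suitable weak solutions of the
  Navier–Stokes equations*, Comm. Pure Appl. Math. 35 (1982), 771–831, §2 (2.8)–(2.10),
  Lemma 5.1.
-/

noncomputable section

open MeasureTheory Set Function Filter TopologicalSpace Metric Module
open scoped NNReal ENNReal InnerProductSpace RealInnerProductSpace Topology

namespace Literature.Analysis.FluidPDE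

/-! ### Two Hölder inequalities -/

section Holder

variable {α : Type*} [MeasurableSpace α]

/-- Lebesgue interpolation `L³ ⊆ (L², L⁶)` in the form
`∫ f³ ≤ (∫ f²)^{3/4} (∫ f⁶)^{1/4}` (Hölder with exponents `4/3` and `4` applied to
`f^{3/2} · f^{3/2}`; Robinson–Rodrigo–Sadowski 2016, Lemma 3.5 with `‖u‖_{L³} ≤ ‖u‖_{L²}^{1/2} ‖u‖_{L⁶}^{1/2}`). [cite: RobinsonRodrigoSadowski2016, Lemma 3.5] -/
theorem lintegral_pow_three_le_Lp_interpolation (μ : Measure α) {f : α → ℝ≥0∞}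
    (hf : AEMeasurable f μ) :
    ∫⁻ x, f x ^ (3 : ℕ) ∂μ ≤
      (∫⁻ x, f x ^ (2 : ℕ) ∂μ) ^ (3 / 4 : ℝ) * (∫⁻ x, f x ^ (6 : ℝ) ∂μ) ^ (1 / 4 : ℝ) := by
  have hpq : (4 / 3 : ℝ).HolderConjugate 4 := Real.holderConjugate_iff.2 ⟨by norm_num, by norm_num⟩
  have key := ENNReal.lintegral_mul_le_Lp_mul_Lq μ hpq (hf.pow_const (3 / 2 : ℝ))
    (hf.pow_const (3 / 2 : ℝ))
  have h1 : ∀ x, f x ^ (3 / 2 : ℝ) * f x ^ (3 / 2 : ℝ) = f x ^ (3 : ℕ) := fun x => by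
    rw [← ENNReal.rpow_add_of_nonneg _ _ (by norm_num) (by norm_num),
      show (3 / 2 : ℝ) + 3 / 2 = ((3 : ℕ) : ℝ) by norm_num, ENNReal.rpow_natCast]
  have h2 : ∀ x, (f x ^ (3 / 2 : ℝ)) ^ (4 / 3 : ℝ) = f x ^ (2 : ℕ) := fun x => by
    rw [← ENNReal.rpow_mul, show (3 / 2 : ℝ) * (4 / 3) = ((2 : ℕ) : ℝ) by norm_num,
      ENNReal.rpow_natCast]
  have h3 : ∀ x, (f x ^ (3 / 2 : ℝ)) ^ (4 : ℝ) = f x ^ (6 : ℝ) := fun x => by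
    rw [← ENNReal.rpow_mul]; norm_num
  simp only [Pi.mul_apply, h1, h2, h3] at key
  rw [show (1 : ℝ) / (4 / 3) = 3 / 4 by norm_num] at key
  exact key

/-- Hölder in time against the constant `1` on a set of measure at most `1`:
`∫ f^{3/4} ≤ (∫ f)^{3/4}`. [folklore] -/
theorem lintegral_rpow_three_quarters_le (μ : Measure α) (hμ : μ univ ≤ 1) {f : α → ℝ≥0∞}
    (hf : AEMeasurable f μ) :
    ∫⁻ x, f x ^ (3 / 4 : ℝ) ∂μ ≤ (∫⁻ x, f x ∂μ) ^ (3 / 4 : ℝ) := by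
  have hpq : (4 / 3 : ℝ).HolderConjugate 4 := Real.holderConjugate_iff.2 ⟨by norm_num, by norm_num⟩
  have key := ENNReal.lintegral_mul_le_Lp_mul_Lq μ hpq (hf.pow_const (3 / 4 : ℝ))
    (g := fun _ => 1) aemeasurable_const
  have h2 : ∀ x, (f x ^ (3 / 4 : ℝ)) ^ (4 / 3 : ℝ) = f x := fun x => by
    rw [← ENNReal.rpow_mul, show (3 / 4 : ℝ) * (4 / 3) = 1 by norm_num, ENNReal.rpow_one]
  simp only [Pi.mul_apply, mul_one, h2, ENNReal.one_rpow, lintegral_const, one_mul] at key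
  rw [show (1 : ℝ) / (4 / 3) = 3 / 4 by norm_num] at key
  refine key.trans ?_
  calc (∫⁻ x, f x ∂μ) ^ (3 / 4 : ℝ) * μ univ ^ (1 / 4 : ℝ)
      ≤ (∫⁻ x, f x ∂μ) ^ (3 / 4 : ℝ) * 1 ^ (1 / 4 : ℝ) := by gcongr
    _ = (∫⁻ x, f x ∂μ) ^ (3 / 4 : ℝ) := by rw [ENNReal.one_rpow, mul_one]

end Holder

/-! ### The Sobolev inequality `H¹(B₁) ⊂ L⁶(B₁)` on the unit ball of `ℝ³` -/

section Sobolev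

/-- `‖g‖_{L²} ≤ (∫⁻ |g|²)^{1/2}` for the Frobenius density `|g(x)|² = ∑ᵢ ‖g(x) eᵢ‖²`, which
dominates the operator norm. [folklore] -/
theorem eLpNorm_two_le_lintegral_frobeniusNormSq_rpow {E : Type*} [NormedAddCommGroup E]
    [InnerProductSpace ℝ E] [FiniteDimensional ℝ E] [MeasurableSpace E] (μ : Measure E)
    (g : E → E →L[ℝ] E) :
    eLpNorm g 2 μ ≤ (∫⁻ x, ENNReal.ofReal (frobeniusNormSq (g x)) ∂μ) ^ (1 / 2 : ℝ) := by
  rw [eLpNorm_eq_lintegral_rpow_enorm_toReal two_ne_zero ENNReal.ofNat_ne_top,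
    ENNReal.toReal_ofNat]
  gcongr with x
  rw [show (2 : ℝ) = ((2 : ℕ) : ℝ) by norm_num, ENNReal.rpow_natCast, ← ofReal_norm,
    ← ENNReal.ofReal_pow (norm_nonneg _)]
  exact ENNReal.ofReal_le_ofReal (sq_opNorm_le_frobeniusNormSq _)

/-- **Sobolev inequality on the unit ball of `ℝ³` for weakly differentiable vector fields.**
There is an absolute constant `C` such that for every `f : ℝ³ → ℝ³` in `L²(B₁)` with a weak
derivative `g` on the unit ball `B₁` (accepted `Literature.Analysis.FunctionSpaces.HasWeakFDerivOn`),
`‖f‖_{L⁶(B₁)} ≤ C (‖f‖_{L²(B₁)} + (∫_{B₁} |g|²)^{1/2})` with the Frobenius density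
`|g|² = ∑ᵢ ‖g eᵢ‖²` (Robinson–Rodrigo–Sadowski 2016, Thm. 1.7/(15.30): `H¹(B_r) ⊂ L⁶(B_r)`;
here from the tree's embedding `W^{1,2}(Ω) ⊂ L⁶(Ω)` on bounded Lipschitz domains,
`Literature.Analysis.FunctionSpaces.exists_eLpNorm_le_of_memSobolevDomain_one`, and `isLipschitzDomain_ball`). If
`∫_{B₁} |g|² = ∞` the right-hand side is `∞`. [cite: RobinsonRodrigoSadowski2016, Lemma 15.10 (proof, Sobolev step)] -/
theorem exists_eLpNorm_six_le_unitBall :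
    ∃ C : ℝ≥0, ∀ (f : EuclideanSpace ℝ (Fin 3) → EuclideanSpace ℝ (Fin 3))
      (g : EuclideanSpace ℝ (Fin 3) → EuclideanSpace ℝ (Fin 3) →L[ℝ] EuclideanSpace ℝ (Fin 3)),
      FunctionSpaces.HasWeakFDerivOn
        (⟨ball (0 : EuclideanSpace ℝ (Fin 3)) 1, isOpen_ball⟩ : Opens (EuclideanSpace ℝ (Fin 3)))
        volume f g →
      eLpNorm f 2 (volume.restrict (ball (0 : EuclideanSpace ℝ (Fin 3)) 1)) ≠ ∞ →
      eLpNorm f 6 (volume.restrict (ball (0 : EuclideanSpace ℝ (Fin 3)) 1)) ≤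
        C * (eLpNorm f 2 (volume.restrict (ball (0 : EuclideanSpace ℝ (Fin 3)) 1)) +
          (∫⁻ x in ball (0 : EuclideanSpace ℝ (Fin 3)) 1,
            ENNReal.ofReal (frobeniusNormSq (g x))) ^ (1 / 2 : ℝ)) := by
  obtain ⟨C, hC⟩ := FunctionSpaces.exists_eLpNorm_le_of_memSobolevDomain_one
    (F := EuclideanSpace ℝ (Fin 3))
    (FunctionSpaces.isLipschitzDomain_ball (0 : EuclideanSpace ℝ (Fin 3)) 1) isBounded_ball
    (p := 2) (p' := 6) one_le_two (by rw [finrank_euclideanSpace_fin]; norm_num)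
    (by rw [finrank_euclideanSpace_fin]; norm_num) volume
  refine ⟨max C 1, fun f g hw hf2 => ?_⟩
  set B : Set (EuclideanSpace ℝ (Fin 3)) := ball 0 1 with hB
  have hg2 := eLpNorm_two_le_lintegral_frobeniusNormSq_rpow (volume.restrict B) g
  by_cases hfin : (∫⁻ x in B, ENNReal.ofReal (frobeniusNormSq (g x))) = ∞
  · rw [hfin, ENNReal.top_rpow_of_pos (by norm_num), add_top, ENNReal.mul_top (by simp)]
    exact le_top
  -- `f ∈ W^{1,2}(B₁)`
  have hfm : AEStronglyMeasurable f (volume.restrict B) :=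
    hw.locallyIntegrableOn.aestronglyMeasurable
  have hf : MemLp f 2 (volume.restrict B) := ⟨hfm, lt_top_iff_ne_top.2 hf2⟩
  have hgm : AEStronglyMeasurable g (volume.restrict B) :=
    hw.locallyIntegrableOn_deriv.aestronglyMeasurable
  have hg : MemLp g 2 (volume.restrict B) :=
    ⟨hgm, hg2.trans_lt (ENNReal.rpow_lt_top_of_nonneg (by norm_num) hfin)⟩
  have hsob : FunctionSpaces.MemSobolevDomain 1 ((2 : ℝ≥0) : ℝ≥0∞)
      (⟨ball (0 : EuclideanSpace ℝ (Fin 3)) 1, isOpen_ball⟩ : Opens (EuclideanSpace ℝ (Fin 3)))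
      volume f := by
    refine FunctionSpaces.memSobolevDomain_succ_iff.2 ⟨by exact_mod_cast hf, g, hw, fun v => ?_⟩
    rw [FunctionSpaces.memSobolevDomain_zero_iff]
    exact_mod_cast (ContinuousLinearMap.apply ℝ (EuclideanSpace ℝ (Fin 3)) v).comp_memLp' hg
  have hS := hC f g hsob hw
  have hS' : eLpNorm f 6 (volume.restrict B) ≤
      C * (eLpNorm f 2 (volume.restrict B) + eLpNorm g 2 (volume.restrict B)) := by
    exact_mod_cast hS
  refine hS'.trans ?_
  gcongr
  · exact_mod_cast le_max_left C 1

end Sobolev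

/-! ### The estimate at unit scale -/

section Unit

/-- The Frobenius norm squared is a continuous function of the linear map. [folklore] -/
theorem continuous_frobeniusNormSq' {E : Type*} [NormedAddCommGroup E] [InnerProductSpace ℝ E]
    [FiniteDimensional ℝ E] :
    Continuous fun L : E →L[ℝ] E => frobeniusNormSq L := by
  unfold frobeniusNormSq
  exact continuous_finsetSum _ fun i _ =>
    ((ContinuousLinearMap.apply ℝ E _).continuous.norm).pow 2

/-- **The interpolation inequality at unit scale** (Robinson–Rodrigo–Sadowski 2016,
Lemma 15.10 with `r = 1`): there is an absolute `C₀` such that for every `u` with weak spatial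
gradient `G` on `Q₁(0) = (-1, 0) × B₁` and `A(1), E(1) < ∞`,
`C(1) ≤ C₀ (A(1) + E(1))^{3/2}`. See the file docstring for the proof. [cite: RobinsonRodrigoSadowski2016, Lemma 15.10 (15.31)] -/
theorem exists_cknC_one_le :
    ∃ C₀ : ℝ≥0, ∀ (u : ℝ → EuclideanSpace ℝ (Fin 3) → EuclideanSpace ℝ (Fin 3))
      (G : ℝ → EuclideanSpace ℝ (Fin 3) → EuclideanSpace ℝ (Fin 3) →L[ℝ] EuclideanSpace ℝ (Fin 3)),
      HasWeakSpatialGradientOn (parabolicCylinderOpens 1 0) u G →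
      cknAEss 1 0 u ≠ ∞ → cknE 1 0 G ≠ ∞ →
      cknC 1 0 u ≤ C₀ * (cknAEss 1 0 u + cknE 1 0 G) ^ (3 / 2 : ℝ) := by
  obtain ⟨CS, hCS⟩ := exists_eLpNorm_six_le_unitBall
  refine ⟨(2 * CS) ^ (3 / 2 : ℝ), fun u G h hA hE => ?_⟩
  -- notation
  set B : Set (EuclideanSpace ℝ (Fin 3)) := ball 0 1 with hB
  set I : Set ℝ := Ioo (-1) 0 with hI
  set a : ℝ → ℝ≥0∞ := fun t => ∫⁻ x in B, ‖u t x‖ₑ ^ 2 with ha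
  set e : ℝ → ℝ≥0∞ := fun t => ∫⁻ x in B, ENNReal.ofReal (frobeniusNormSq (G t x)) with he
  set c : ℝ → ℝ≥0∞ := fun t => ∫⁻ x in B, ‖u t x‖ₑ ^ (3 : ℕ) with hc
  have hQ : parabolicCylinder 1 (0 : ℝ × EuclideanSpace ℝ (Fin 3)) = I ×ˢ B := by
    simp [parabolicCylinder, hI, hB]
  have hQI : Ioo ((0 : ℝ × EuclideanSpace ℝ (Fin 3)).1 - 1 ^ 2) (0 : ℝ × EuclideanSpace ℝ (Fin 3)).1 = I := by
    simp [hI]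
  -- the quantities at unit scale
  have hAeq : cknAEss 1 0 u = essSup a (volume.restrict I) := by
    simp only [cknAEss, ENNReal.ofReal_one, inv_one, one_mul, hQI]
    rfl
  have hEeq : cknE 1 0 G = ∫⁻ q in I ×ˢ B, ENNReal.ofReal (frobeniusNormSq (G q.1 q.2)) := by
    simp only [cknE, ENNReal.ofReal_one, inv_one, one_mul, hQ]
  have hCeq : cknC 1 0 u = ∫⁻ q in I ×ˢ B, ‖u q.1 q.2‖ₑ ^ (3 : ℕ) := by
    simp only [cknC, ENNReal.ofReal_one, one_pow, inv_one, one_mul, hQ]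
  -- measurability on the cylinder
  have hQsub : I ×ˢ B ⊆ ((parabolicCylinderOpens 1 (0 : ℝ × EuclideanSpace ℝ (Fin 3)) :
      Opens (ℝ × EuclideanSpace ℝ (Fin 3))) : Set (ℝ × EuclideanSpace ℝ (Fin 3))) := by
    rw [coe_parabolicCylinderOpens, hQ]
  have hum : AEStronglyMeasurable (uncurry u) (volume.restrict (I ×ˢ B)) :=
    (h.locallyIntegrableOn.mono_set hQsub).aestronglyMeasurable
  have hGm : AEStronglyMeasurable (uncurry G) (volume.restrict (I ×ˢ B)) :=
    (h.locallyIntegrableOn_grad.mono_set hQsub).aestronglyMeasurable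
  have hprod : (volume.restrict (I ×ˢ B) : Measure (ℝ × EuclideanSpace ℝ (Fin 3))) =
      (volume.restrict I).prod (volume.restrict B) := by
    rw [Measure.volume_eq_prod, Measure.prod_restrict]
  have hum3 : AEMeasurable (fun q : ℝ × EuclideanSpace ℝ (Fin 3) => ‖u q.1 q.2‖ₑ ^ (3 : ℕ))
      ((volume.restrict I).prod (volume.restrict B)) := by
    rw [← hprod]; exact (hum.enorm.pow_const 3)
  have hum2 : AEMeasurable (fun q : ℝ × EuclideanSpace ℝ (Fin 3) => ‖u q.1 q.2‖ₑ ^ (2 : ℕ))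
      ((volume.restrict I).prod (volume.restrict B)) := by
    rw [← hprod]; exact (hum.enorm.pow_const 2)
  have hGm2 : AEMeasurable (fun q : ℝ × EuclideanSpace ℝ (Fin 3) =>
      ENNReal.ofReal (frobeniusNormSq (G q.1 q.2))) ((volume.restrict I).prod (volume.restrict B)) := by
    rw [← hprod]
    exact (continuous_frobeniusNormSq'.comp_aestronglyMeasurable hGm).aemeasurable.ennreal_ofReal
  -- Tonelli
  have hEeq' : cknE 1 0 G = ∫⁻ t in I, e t := by
    rw [hEeq, Measure.volume_eq_prod, setLIntegral_prod _ (by rwa [← Measure.prod_restrict])]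
  have hCeq' : cknC 1 0 u = ∫⁻ t in I, c t := by
    rw [hCeq, Measure.volume_eq_prod, setLIntegral_prod _ (by rwa [← Measure.prod_restrict])]
  have ham : AEMeasurable a (volume.restrict I) := hum2.lintegral_prod_right'
  have hem : AEMeasurable e (volume.restrict I) := hGm2.lintegral_prod_right'
  -- a.e. in time: energy bound, finite dissipation, weak derivative of the slice
  set A := cknAEss 1 0 u with hAdef
  set EE := cknE 1 0 G with hEdef
  have h1 : ∀ᵐ t ∂(volume.restrict I), a t ≤ A := by
    rw [hAeq]; exact ENNReal.ae_le_essSup a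
  have h2 : ∀ᵐ t ∂(volume.restrict I), e t < ∞ := by
    refine ae_lt_top' hem ?_
    rw [← hEeq']; exact hE
  have h3 : ∀ᵐ t ∂(volume.restrict I), FunctionSpaces.HasWeakFDerivOn
      (⟨B, isOpen_ball⟩ : Opens (EuclideanSpace ℝ (Fin 3))) volume (u t) (G t) := by
    have := h.ae_hasWeakFDerivOn_ball
    rwa [hQI] at this
  -- the pointwise-in-time estimate
  have hAtop : A ≠ ∞ := hA
  have hpt : ∀ᵐ t ∂(volume.restrict I),
      c t ≤ A ^ (3 / 4 : ℝ) * (((2 * CS : ℝ≥0) : ℝ≥0∞) ^ (3 / 2 : ℝ) * (a t + e t) ^ (3 / 4 : ℝ)) := by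
    filter_upwards [h1, h2, h3] with t hat het hwt
    have hat' : a t ≠ ∞ := ne_top_of_le_ne_top hAtop hat
    -- measurability of the slice
    have hutm : AEStronglyMeasurable (u t) (volume.restrict B) :=
      hwt.locallyIntegrableOn.aestronglyMeasurable
    -- `‖u t‖_{L²(B)} = a(t)^{1/2}`
    have hL2 : eLpNorm (u t) 2 (volume.restrict B) = a t ^ (1 / 2 : ℝ) := by
      rw [eLpNorm_eq_lintegral_rpow_enorm_toReal two_ne_zero ENNReal.ofNat_ne_top,
        ENNReal.toReal_ofNat, ha]
      simp only [one_div]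
      congr 1
      refine lintegral_congr fun x => ?_
      rw [show (2 : ℝ) = ((2 : ℕ) : ℝ) by norm_num, ENNReal.rpow_natCast]
    have hL2' : eLpNorm (u t) 2 (volume.restrict B) ≠ ∞ := by
      rw [hL2]; exact ENNReal.rpow_ne_top_of_nonneg (by norm_num) hat'
    -- Sobolev on the slice
    have hS : eLpNorm (u t) 6 (volume.restrict B) ≤
        CS * (a t ^ (1 / 2 : ℝ) + e t ^ (1 / 2 : ℝ)) := by
      have := hCS (u t) (G t) hwt hL2'
      rwa [hL2] at this
    have hS2 : eLpNorm (u t) 6 (volume.restrict B) ≤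
        ((2 * CS : ℝ≥0) : ℝ≥0∞) * (a t + e t) ^ (1 / 2 : ℝ) := by
      refine hS.trans ?_
      have h1' : a t ^ (1 / 2 : ℝ) ≤ (a t + e t) ^ (1 / 2 : ℝ) :=
        ENNReal.rpow_le_rpow le_self_add (by norm_num)
      have h2' : e t ^ (1 / 2 : ℝ) ≤ (a t + e t) ^ (1 / 2 : ℝ) :=
        ENNReal.rpow_le_rpow le_add_self (by norm_num)
      calc (CS : ℝ≥0∞) * (a t ^ (1 / 2 : ℝ) + e t ^ (1 / 2 : ℝ))
          ≤ CS * ((a t + e t) ^ (1 / 2 : ℝ) + (a t + e t) ^ (1 / 2 : ℝ)) := by gcongr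
        _ = ((2 * CS : ℝ≥0) : ℝ≥0∞) * (a t + e t) ^ (1 / 2 : ℝ) := by push_cast; ring
    -- `(∫ |u t|⁶)^{1/4} = ‖u t‖_{L⁶}^{3/2}`
    have hL6 : (∫⁻ x in B, ‖u t x‖ₑ ^ (6 : ℝ)) ^ (1 / 4 : ℝ) =
        eLpNorm (u t) 6 (volume.restrict B) ^ (3 / 2 : ℝ) := by
      rw [eLpNorm_eq_lintegral_rpow_enorm_toReal (by norm_num) ENNReal.ofNat_ne_top,
        ENNReal.toReal_ofNat, ← ENNReal.rpow_mul]
      norm_num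
    -- Hölder in space
    have hH := lintegral_pow_three_le_Lp_interpolation (volume.restrict B) hutm.enorm
    calc c t ≤ a t ^ (3 / 4 : ℝ) * (∫⁻ x in B, ‖u t x‖ₑ ^ (6 : ℝ)) ^ (1 / 4 : ℝ) := hH
      _ = a t ^ (3 / 4 : ℝ) * eLpNorm (u t) 6 (volume.restrict B) ^ (3 / 2 : ℝ) := by rw [hL6]
      _ ≤ A ^ (3 / 4 : ℝ) * (((2 * CS : ℝ≥0) : ℝ≥0∞) * (a t + e t) ^ (1 / 2 : ℝ)) ^ (3 / 2 : ℝ) := by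
          gcongr
      _ = A ^ (3 / 4 : ℝ) * (((2 * CS : ℝ≥0) : ℝ≥0∞) ^ (3 / 2 : ℝ) * (a t + e t) ^ (3 / 4 : ℝ)) := by
          rw [ENNReal.mul_rpow_of_nonneg _ _ (by norm_num), ← ENNReal.rpow_mul]
          norm_num
  -- integrate in time
  have hK : A ^ (3 / 4 : ℝ) * ((2 * CS : ℝ≥0) : ℝ≥0∞) ^ (3 / 2 : ℝ) ≠ ∞ :=
    ENNReal.mul_ne_top (ENNReal.rpow_ne_top_of_nonneg (by norm_num) hAtop)
      (ENNReal.rpow_ne_top_of_nonneg (by norm_num) ENNReal.coe_ne_top)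
  have hvolI : (volume.restrict I : Measure ℝ) univ ≤ 1 := by
    rw [Measure.restrict_apply_univ, hI, Real.volume_Ioo]; norm_num
  have hint_a : ∫⁻ t in I, a t ≤ A := by
    calc ∫⁻ t in I, a t ≤ ∫⁻ _ in I, A := lintegral_mono_ae h1
      _ = A * (volume.restrict I) univ := lintegral_const A
      _ ≤ A * 1 := by gcongr
      _ = A := mul_one A
  calc cknC 1 0 u = ∫⁻ t in I, c t := hCeq'
    _ ≤ ∫⁻ t in I, A ^ (3 / 4 : ℝ) * (((2 * CS : ℝ≥0) : ℝ≥0∞) ^ (3 / 2 : ℝ) *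
          (a t + e t) ^ (3 / 4 : ℝ)) := lintegral_mono_ae hpt
    _ = A ^ (3 / 4 : ℝ) * ((2 * CS : ℝ≥0) : ℝ≥0∞) ^ (3 / 2 : ℝ) *
          ∫⁻ t in I, (a t + e t) ^ (3 / 4 : ℝ) := by
        rw [← lintegral_const_mul' _ _ hK]
        refine lintegral_congr fun t => ?_
        ring
    _ ≤ A ^ (3 / 4 : ℝ) * ((2 * CS : ℝ≥0) : ℝ≥0∞) ^ (3 / 2 : ℝ) *
          (∫⁻ t in I, (a t + e t)) ^ (3 / 4 : ℝ) := by
        gcongr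
        exact lintegral_rpow_three_quarters_le _ hvolI (ham.add hem)
    _ ≤ A ^ (3 / 4 : ℝ) * ((2 * CS : ℝ≥0) : ℝ≥0∞) ^ (3 / 2 : ℝ) * (A + EE) ^ (3 / 4 : ℝ) := by
        gcongr
        rw [lintegral_add_left' ham, ← hEeq']
        gcongr
    _ ≤ (A + EE) ^ (3 / 4 : ℝ) * ((2 * CS : ℝ≥0) : ℝ≥0∞) ^ (3 / 2 : ℝ) * (A + EE) ^ (3 / 4 : ℝ) := by
        gcongr
        exact le_self_add
    _ = (((2 * CS) ^ (3 / 2 : ℝ) : ℝ≥0) : ℝ≥0∞) * (A + EE) ^ (3 / 2 : ℝ) := by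
        rw [ENNReal.coe_rpow_of_nonneg _ (by norm_num), mul_comm _ (((2 * CS : ℝ≥0) : ℝ≥0∞) ^ _),
          mul_assoc, ← ENNReal.rpow_add_of_nonneg _ _ (by norm_num) (by norm_num)]
        norm_num

end Unit

/-! ### Scaling to arbitrary cylinders and the discharge of `interpolationEstimate` -/

section Scaling

/-- The parabolic zoom `Φ(s, y) = (t + r² s, x + r y)` maps `Q₁(0)` onto `Q_r(t, x)`:
preimage form for the `Opens`. [folklore] -/
theorem stPreimage_parabolicCylinderOpens_self {r : ℝ} (hr : 0 < r)
    (z : ℝ × EuclideanSpace ℝ (Fin 3)) :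
    stPreimage (r ^ 2) r z.1 z.2 (parabolicCylinderOpens r z) = parabolicCylinderOpens 1 0 := by
  refine TopologicalSpace.Opens.ext ?_
  rw [coe_stPreimage, coe_parabolicCylinderOpens, coe_parabolicCylinderOpens]
  have hz : stAffine (r ^ 2) r z.1 z.2 (0 : ℝ × EuclideanSpace ℝ (Fin 3)) = z :=
    Prod.ext (by simp [stAffine]) (by simp [stAffine])
  have := LocalTypeIScaling.stAffine_preimage_parabolicCylinder hr z.1 z.2 1 0
  rwa [mul_one, hz] at this

/-- **The interpolation inequality** `C(r) ≤ C₀ (A(r) + E(r))^{3/2}` for every cylinder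
(Robinson–Rodrigo–Sadowski 2016, Lemma 15.10, (15.31): "there exists a constant `C₀`, which does
not depend on `r`, such that ... `r⁻² ∫_{Q_r} |u|³ ≤ C₀ [r⁻¹ sup_t ∫_{B_r} |u(t)|² + r⁻¹ ∫_{Q_r} |∇u|²]^{3/2}`";
Caffarelli–Kohn–Nirenberg 1982, Lemma 5.1), in the accepted vocabulary: for `u` with weak
spatial gradient `G` on `Q_r(z)` and `A = cknAEss`, `E = cknE` finite,
`cknC r z u ≤ C₀ (cknAEss r z u + cknE r z G)^{3/2}`. From the unit-scale case by the
Navier–Stokes scaling `u ↦ r u(t + r² s, x + r y)`. [cite: RobinsonRodrigoSadowski2016, Lemma 15.10 (15.31)] -/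
theorem exists_cknC_le_rpow :
    ∃ C₀ : ℝ≥0, ∀ (u : ℝ → EuclideanSpace ℝ (Fin 3) → EuclideanSpace ℝ (Fin 3))
      (G : ℝ → EuclideanSpace ℝ (Fin 3) → EuclideanSpace ℝ (Fin 3) →L[ℝ] EuclideanSpace ℝ (Fin 3))
      (z : ℝ × EuclideanSpace ℝ (Fin 3)) (r : ℝ), 0 < r →
      HasWeakSpatialGradientOn (parabolicCylinderOpens r z) u G →
      cknAEss r z u ≠ ∞ → cknE r z G ≠ ∞ →
      cknC r z u ≤ C₀ * (cknAEss r z u + cknE r z G) ^ (3 / 2 : ℝ) := by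
  obtain ⟨C₀, hC₀⟩ := exists_cknC_one_le
  refine ⟨C₀, fun u G z r hr h hA hE => ?_⟩
  have hr2 : 0 < r ^ 2 := by positivity
  -- the rescaled pair on `Q₁(0)`
  have hz : stAffine (r ^ 2) r z.1 z.2 (0 : ℝ × EuclideanSpace ℝ (Fin 3)) = z :=
    Prod.ext (by simp [stAffine]) (by simp [stAffine])
  have hC : cknC 1 0 (r • stPull (r ^ 2) r z.1 z.2 u) = cknC r z u := by
    simpa [hz] using cknC_nsZoom hr one_pos z.1 z.2 0 u
  have hAe : cknAEss 1 0 (r • stPull (r ^ 2) r z.1 z.2 u) = cknAEss r z u := by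
    simpa [hz] using cknAEss_nsZoom hr one_pos z.1 z.2 0 u
  have hEe : cknE 1 0 (r ^ 2 • stPull (r ^ 2) r z.1 z.2 G) = cknE r z G := by
    simpa [hz] using cknE_nsZoom hr one_pos z.1 z.2 0 G
  have hw : HasWeakSpatialGradientOn (parabolicCylinderOpens 1 0) (r • stPull (r ^ 2) r z.1 z.2 u)
      (r ^ 2 • stPull (r ^ 2) r z.1 z.2 G) := by
    have := h.stRescale r hr2 hr z.1 z.2
    rwa [stPreimage_parabolicCylinderOpens_self hr, ← sq] at this
  have := hC₀ _ _ hw (by rwa [hAe]) (by rwa [hEe])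
  rwa [hC, hAe, hEe] at this

/-- **Discharge of the decomposition target `interpolationEstimate`** of
`CKNEpsilonRegularityAssembly.lean` (Robinson–Rodrigo–Sadowski 2016, Lemma 15.10, (15.31);
Caffarelli–Kohn–Nirenberg 1982, §2 and Lemma 5.1): one of the four hypotheses of
`Literature.Analysis.FluidPDE.ckn_epsilon_regularity_of_estimates` is now a theorem. [cite: RobinsonRodrigoSadowski2016, Lemma 15.10 (15.31)] -/
theorem interpolationEstimate_holds : interpolationEstimate :=
  exists_cknC_le_rpow

end Scaling

end Literature.Analysis.FluidPDE
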